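import Mathlib.Analysis.SpecialFunctions.SmoothTransition
import Literature.Topology.FourManifolds.CobordismAttachmentProofs
import HarnessLib

/-!
# Collars adapted to an adapted Morse function and to a Morse function of a triad
# (Milnor 1965, Lemma 3.7, collar part)

Topic `Literature/Topology/FourManifolds`; second of the three files proving Milnor, *Lectures on
the h-cobordism theorem* (1965), Lemma 3.7 / Cor. 3.8 for the attachment `W ∪_ψ X`
(`AttachDataMorseProfile.lean`, this file, `AttachDataMorseGluing.lean`).

Milnor's proof of Lemma 3.7 (PDF p. 15) reads the Morse functions of the two triads as the collar
coordinates near the common boundary (Cor. 3.5: the collar is the flow-out of the boundary along a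
normalised gradient-like field, proof of Thm. 3.4).  Here, in the tree's language: the long open
collars fed to the attachment datum `AttachData` (`CobordismAttachmentProofs.lean`) are the
flow-out collars `FlowoutInput.Cover.openCollar` (`OpenCollarExistence.lean`) of

* `1 - f` for an adapted Morse function `f` of `W` (`IsMorseAdapted.exists_flowoutInput`), so that
  `1 - f = a_W h / (1 + h)` in the collar height `h` (`f_eq_of_mem_region`);
* `φ ∘ g` for a Morse function `g` of the triad `(X; M, N)`
  (`Cobordism.IsMorseFunction.exists_flowoutInput_eqOn_ends`; the tree's
  `Cobordism.IsMorseFunction.exists_flowoutInput` of `CobordismEndLevels.lean` uses `g (1 - g)`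
  instead, whose inverse on the collar is a square root), where `φ w = w` for `w ≤ 1/4` and
  `= 1 - w` for `w ≥ 1/2` (`exists_endsFun`, a two-ended boundary-defining function built from
  `g`), so that
  `g = a_X s / (1 + s)` in the collar height `s` over the incoming end `M` once `a_X ≤ 1/4`
  (`g_eq_of_mem_regionOver`: along a collar line from `M` the value `g = 1/4` is never reached,
  by the intermediate value theorem).

Both flow-out functions are regular on `{· ≤ δ}` (`FlowoutInput.not_isMCriticalPt_of_le`), which
keeps the critical points of `f` and `g` out of collars of height `a ≤ δ`
(`FlowoutInput.Cover.exists_a_le`).  Everything here is proved (theorems only).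

## References

* J. Milnor, *Lectures on the h-cobordism theorem*, Princeton (1965), Lemma 2.6, Cor. 3.5,
  Lemma 3.7 (PDF pp. 6, 14–15). [MilnorHCobordism1965]
-/

open scoped Manifold ContDiff Topology
open Set Function Filter

noncomputable section

namespace Literature.Topology.FourManifolds

universe u

/-! ### Two lemmas on critical points of composites -/

section Comp

variable {E H : Type*} [NormedAddCommGroup E] [NormedSpace ℝ E] [TopologicalSpace H]
  {I : ModelWithCorners ℝ E H} {Z : Type*} [TopologicalSpace Z] [ChartedSpace H Z]

/-- A critical point of `g` is a critical point of every composite `σ ∘ g` (chain rule).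
[folklore] -/
theorem isMCriticalPt_comp_of_hasDerivAt {g : Z → ℝ} {σ : ℝ → ℝ} {d : ℝ} {x : Z}
    (hσ : HasDerivAt σ d (g x)) (hg : MDifferentiableAt I 𝓘(ℝ, ℝ) g x) (hc : IsMCriticalPt I g x) :
    IsMCriticalPt I (σ ∘ g) x := by
  have h : HasMFDerivAt I 𝓘(ℝ, ℝ) (σ ∘ g) x
      ((ContinuousLinearMap.smulRight (1 : ℝ →L[ℝ] ℝ) d).comp (mfderiv I 𝓘(ℝ, ℝ) g x)) :=
    HasMFDerivAt.comp x hσ.hasFDerivAt.hasMFDerivAt hg.hasMFDerivAt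
  rw [isMCriticalPt_iff_forall_apply] at hc ⊢
  intro v
  rw [h.mfderiv]
  change (show ℝ from mfderiv I 𝓘(ℝ, ℝ) g x v) * d = 0
  rw [hc v]
  exact zero_mul d

/-- `1 - f` is critical exactly where `f` is. [folklore] -/
theorem isMCriticalPt_one_sub_iff {f : Z → ℝ} {x : Z} (hf : MDifferentiableAt I 𝓘(ℝ, ℝ) f x) :
    IsMCriticalPt I (fun z => 1 - f z) x ↔ IsMCriticalPt I f x := by
  have hd : HasDerivAt (fun w : ℝ => 1 - w) (-1) (f x) := by
    simpa using (hasDerivAt_id (f x)).const_sub 1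
  exact isMCriticalPt_comp_iff_of_hasDerivAt (σ := fun w : ℝ => 1 - w) hd (by norm_num) hf

end Comp

/-! ### Flow-out inputs: regularity near the boundary, covers of capped height -/

namespace FlowoutInput

variable {k : ℕ} {M : Type u} [TopologicalSpace M] [ChartedSpace (EuclideanHalfSpace (k + 1)) M]
  [IsManifold (𝓡∂ (k + 1)) ∞ M] (D : FlowoutInput k M)

/-- The flow-out function is regular on `{f ≤ δ}` (there `ξ(f) = 1`). [folklore] -/
theorem not_isMCriticalPt_of_le {z : M} (hz : D.f z ≤ D.δ) : ¬ IsMCriticalPt (𝓡∂ (k + 1)) D.f z := by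
  intro h
  have h1 := D.mlineDeriv_f_ξ z hz
  rw [mlineDeriv_def, show mfderiv (𝓡∂ (k + 1)) 𝓘(ℝ, ℝ) D.f z = 0 from h] at h1
  have h2 : (0 : ℝ) = 1 := h1
  exact one_ne_zero h2.symm

/-- A critical point of the flow-out function lies above `δ`. [folklore] -/
theorem lt_of_isMCriticalPt {z : M} (hz : IsMCriticalPt (𝓡∂ (k + 1)) D.f z) : D.δ < D.f z :=
  not_le.1 fun h => D.not_isMCriticalPt_of_le h hz

variable {D}

/-- **A cover of height at most `a₀`** (cap the height of any cover; same boxes). [folklore] -/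
theorem Cover.exists_a_le (Γ : D.Cover) (a₀ : ℝ) (h₀ : 0 < a₀) : ∃ Γ' : D.Cover, Γ'.a ≤ a₀ ∧ Γ'.a ≤ Γ.a :=
  ⟨{ T := Γ.T, f_lt := Γ.f_lt, a := min Γ.a a₀, a_pos := lt_min Γ.a_pos h₀,
     a_le := fun y hy => (min_le_left _ _).trans (Γ.a_le y hy),
     cover := fun z hz => Γ.cover z (hz.trans (min_le_left _ _)) }, min_le_right _ _, min_le_left _ _⟩

/-- **The flow-out function in the flow-out collar**: `f = a s / (1 + s)` in the collar height
`s` on the collar region. [cite: MilnorHCobordism1965, proof of Thm. 3.4] -/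
theorem Cover.f_eq_collarStretch_height [T2Space M] (b : BoundaryData (𝓡∂ (k + 1)) M (𝓡 k))
    [Nonempty b.carrier] (Γ : D.Cover) {z : M} (hz : z ∈ (Γ.openCollar b).region) :
    D.f z = collarStretch Γ.a ((Γ.openCollar b).height z) := by
  conv_lhs => rw [← (Γ.openCollar b).apply_proj_height z hz]
  exact Γ.f_Fl_incl_collarStretch b _ ((Γ.openCollar b).height_nonneg z hz)

/-- In the flow-out collar, `f < a`. [folklore] -/
theorem Cover.f_lt_of_mem_region [T2Space M] (b : BoundaryData (𝓡∂ (k + 1)) M (𝓡 k))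
    [Nonempty b.carrier] (Γ : D.Cover) {z : M} (hz : z ∈ (Γ.openCollar b).region) : D.f z < Γ.a := hz

end FlowoutInput

/-! ### The flow-out input of an adapted Morse function -/

section Adapted

variable {n : ℕ} {W : Type u} [TopologicalSpace W] [T2Space W] [CompactSpace W]
  [ChartedSpace (EuclideanHalfSpace (n + 1)) W] [IsManifold (𝓡∂ (n + 1)) ∞ W]

/-- **The flow-out input of an adapted Morse function**: `1 - f` is `≥ 0`, vanishes exactly on
`∂W` and is regular there (Milnor 1965, Def. 3.1 with `V₀ = ∅`), so the construction of
`FlowoutInput.nonempty_of_compactSpace` applies to it verbatim. [cite: MilnorHCobordism1965, Lemma 2.6, Cor. 3.5 and proof of Thm. 3.4] -/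
theorem IsMorseAdapted.exists_flowoutInput {f : W → ℝ} (hf : IsMorseAdapted (𝓡∂ (n + 1)) f) :
    ∃ D : FlowoutInput n W, D.f = fun z => 1 - f z := by
  classical
  obtain ⟨⟨hfs₁, -⟩, hbd, hint⟩ := hf
  set F : W → ℝ := fun z => 1 - f z with hF
  have hFs : ContMDiff (𝓡∂ (n + 1)) 𝓘(ℝ, ℝ) ∞ F :=
    ((contDiff_const (c := (1 : ℝ))).sub contDiff_id).contMDiff.comp hfs₁
  have hFb : ∀ z, F z = 0 ↔ z ∈ (𝓡∂ (n + 1)).boundary W := by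
    intro z
    constructor
    · intro hz
      by_contra hzb
      have hzi : (𝓡∂ (n + 1)).IsInteriorPoint z :=
        ((𝓡∂ (n + 1)).isInteriorPoint_or_isBoundaryPoint z).resolve_right hzb
      have h := hint z hzi
      simp only [hF] at hz
      linarith
    · intro hz
      simp only [hF, (hbd z hz).1, sub_self]
  have hF0 : ∀ z, 0 ≤ F z := by
    intro z
    rcases (𝓡∂ (n + 1)).isInteriorPoint_or_isBoundaryPoint z with hzi | hzb
    · have h := hint z hzi
      simp only [hF]; linarith
    · simp only [hF, (hbd z hzb).1, sub_self, le_refl]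
  have hreg : ∀ z, F z = 0 → mfderiv (𝓡∂ (n + 1)) 𝓘(ℝ, ℝ) F z ≠ 0 := by
    intro z hz hcrit
    have hzb := (hFb z).1 hz
    exact (hbd z hzb).2 ((isMCriticalPt_one_sub_iff (hfs₁.mdifferentiableAt (by simp))).1 hcrit)
  obtain ⟨δ', hδ', hδ'reg⟩ := exists_pos_forall_mfderiv_ne_zero hFs hF0 hreg
  set δ := δ' / 2 with hδ
  have hδpos : 0 < δ := by positivity
  have hreg2 : ∀ z ∈ {z : W | F z ≤ δ}, mfderiv (𝓡∂ (n + 1)) 𝓘(ℝ, ℝ) F z ≠ 0 := fun z hz =>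
    hδ'reg z (by simp only [mem_setOf_eq] at hz; linarith)
  obtain ⟨ξ, hξ⟩ := exists_contMDiffSection_mlineDeriv_eq_one_on hFs
    (isClosed_le hFs.continuous continuous_const) hreg2
  exact ⟨⟨F, ξ, δ, hδpos, hFs, hF0, hFb, ξ.contMDiff, fun z hz => hξ z hz⟩, rfl⟩

end Adapted

/-! ### A two-ended boundary-defining function from a Morse function of a triad -/

section Ends

/-- **A two-ended reparametrisation** `φ w = (1 - χ₂ w) w + χ₂ w (1 - w)`,
`χ₂ = smoothTransition (4w - 1)`: smooth, equal to `w` on `(-∞, 1/4]`, to `1 - w` on `[1/2, ∞)`,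
positive on `(0, 1)`. [folklore] -/
theorem exists_endsFun : ∃ φ : ℝ → ℝ, ContDiff ℝ ∞ φ ∧ (∀ w, w ≤ 1 / 4 → φ w = w) ∧
    (∀ w, 1 / 2 ≤ w → φ w = 1 - w) ∧ (∀ w, 0 < w → w < 1 → 0 < φ w) := by
  set χ : ℝ → ℝ := fun w => Real.smoothTransition (4 * w - 1) with hχ
  have hχ0 : ∀ w, w ≤ 1 / 4 → χ w = 0 := fun w hw =>
    Real.smoothTransition.zero_of_nonpos (by linarith)
  have hχ1 : ∀ w, 1 / 2 ≤ w → χ w = 1 := fun w hw =>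
    Real.smoothTransition.one_of_one_le (by linarith)
  have hχI : ∀ w, χ w ∈ Icc (0 : ℝ) 1 := fun w =>
    ⟨Real.smoothTransition.nonneg _, Real.smoothTransition.le_one _⟩
  have hχs : ContDiff ℝ ∞ χ :=
    Real.smoothTransition.contDiff.comp ((contDiff_const.mul contDiff_id).sub contDiff_const)
  refine ⟨fun w => (1 - χ w) * w + χ w * (1 - w), ?_, fun w hw => by simp [hχ0 w hw],
    fun w hw => by simp [hχ1 w hw], fun w h0 h1 => ?_⟩
  · exact ((contDiff_const.sub hχs).mul contDiff_id).add (hχs.mul (contDiff_const.sub contDiff_id))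
  · have h := hχI w
    rcases eq_or_lt_of_le h.2 with h2 | h2
    · simp only [h2]; linarith
    · nlinarith [h.1]

variable {n : ℕ} {M N : Type u} [TopologicalSpace M] [ChartedSpace (EuclideanSpace ℝ (Fin n)) M]
  [TopologicalSpace N] [ChartedSpace (EuclideanSpace ℝ (Fin n)) N] {X : Cobordism n M N}

/-- **The flow-out input of a Morse function of a triad**: for `φ` as in `exists_endsFun`,
`φ ∘ g` is `≥ 0`, vanishes exactly on `∂X = M ⊔ N` (`g = 0` on `M`, `= 1` on `N`, `∈ (0, 1)`
inside) and is regular there (`g` has no critical point on `∂X`; `φ' = ±1` at `0`, `1`), so the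
construction of `FlowoutInput.nonempty_of_compactSpace` applies; only smoothness and `φ w = w`
for `w ≤ 1/4` are recorded for the consumer. [cite: MilnorHCobordism1965, Def. 2.3, Lemma 2.6 and proof of Thm. 3.4] -/
theorem Cobordism.IsMorseFunction.exists_flowoutInput_eqOn_ends {g : X.W → ℝ} (hg : X.IsMorseFunction g) :
    ∃ (φ : ℝ → ℝ) (D : FlowoutInput n X.W),
      ContDiff ℝ ∞ φ ∧ (∀ w, w ≤ 1 / 4 → φ w = w) ∧ D.f = fun z => φ (g z) := by
  classical
  obtain ⟨φ, hφs, hφ0, hφ1, hφpos⟩ := exists_endsFun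
  obtain ⟨⟨hgs, -⟩, h0, h1, hbd, hint⟩ := hg
  set F : X.W → ℝ := fun z => φ (g z) with hF
  have hFs : ContMDiff (𝓡∂ (n + 1)) 𝓘(ℝ, ℝ) ∞ F := hφs.contMDiff.comp hgs
  have hFb : ∀ z, F z = 0 ↔ z ∈ (𝓡∂ (n + 1)).boundary X.W := by
    intro z
    constructor
    · intro hz
      by_contra hzb
      have hzi : z ∈ (𝓡∂ (n + 1)).interior X.W :=
        ((𝓡∂ (n + 1)).isInteriorPoint_or_isBoundaryPoint z).resolve_right hzb
      have h := hint z hzi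
      have := hφpos _ h.1 h.2
      simp only [hF] at hz
      linarith
    · intro hz
      rw [← X.range_inl_union_range_inr] at hz
      rcases hz with ⟨x, rfl⟩ | ⟨y, rfl⟩
      · simp only [hF, h0 x, hφ0 0 (by norm_num)]
      · simp only [hF, h1 y, hφ1 1 (by norm_num), sub_self]
  have hF0 : ∀ z, 0 ≤ F z := by
    intro z
    rcases (𝓡∂ (n + 1)).isInteriorPoint_or_isBoundaryPoint z with hzi | hzb
    · exact (hφpos _ (hint z hzi).1 (hint z hzi).2).le
    · exact ((hFb z).2 hzb).ge
  have hreg : ∀ z, F z = 0 → mfderiv (𝓡∂ (n + 1)) 𝓘(ℝ, ℝ) F z ≠ 0 := by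
    intro z hz hcrit
    have hzb := (hFb z).1 hz
    have hgd : MDifferentiableAt (𝓡∂ (n + 1)) 𝓘(ℝ, ℝ) g z := hgs.mdifferentiableAt (by simp)
    have hzb' := hzb
    rw [← X.range_inl_union_range_inr] at hzb'
    rcases hzb' with ⟨x, rfl⟩ | ⟨y, rfl⟩
    · have hd : HasDerivAt φ 1 (g (X.inl x)) := by
        have hev : φ =ᶠ[𝓝 (g (X.inl x))] id := by
          rw [h0 x]
          filter_upwards [Iio_mem_nhds (show (0 : ℝ) < 1 / 4 by norm_num)] with v hv
          exact hφ0 v hv.le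
        exact (hasDerivAt_id _).congr_of_eventuallyEq hev
      exact hbd _ hzb ((isMCriticalPt_comp_iff_of_hasDerivAt hd one_ne_zero hgd).1 hcrit)
    · have hd : HasDerivAt φ (-1) (g (X.inr y)) := by
        have hev : φ =ᶠ[𝓝 (g (X.inr y))] fun v => 1 - v := by
          rw [h1 y]
          filter_upwards [Ioi_mem_nhds (show (1 : ℝ) / 2 < 1 by norm_num)] with v hv
          exact hφ1 v hv.le
        have h' : HasDerivAt (fun v : ℝ => 1 - v) (-1) (g (X.inr y)) := by
          simpa using (hasDerivAt_id (g (X.inr y))).const_sub 1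
        exact h'.congr_of_eventuallyEq hev
      exact hbd _ hzb ((isMCriticalPt_comp_iff_of_hasDerivAt hd (by norm_num) hgd).1 hcrit)
  obtain ⟨δ', hδ', hδ'reg⟩ := exists_pos_forall_mfderiv_ne_zero hFs hF0 hreg
  set δ := δ' / 2 with hδ
  have hδpos : 0 < δ := by positivity
  have hreg2 : ∀ z ∈ {z : X.W | F z ≤ δ}, mfderiv (𝓡∂ (n + 1)) 𝓘(ℝ, ℝ) F z ≠ 0 := fun z hz =>
    hδ'reg z (by simp only [mem_setOf_eq] at hz; linarith)
  obtain ⟨ξ, hξ⟩ := exists_contMDiffSection_mlineDeriv_eq_one_on hFs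
    (isClosed_le hFs.continuous continuous_const) hreg2
  exact ⟨φ, ⟨F, ξ, δ, hδpos, hFs, hF0, hFb, ξ.contMDiff, fun z hz => hξ z hz⟩, hφs, hφ0, rfl⟩

/-- **On the collar over the incoming end, `g` is the stretched collar height** (`a ≤ 1/4`):
along the collar line `t ↦ C (inl m) t` the flow-out function `φ ∘ g` equals
`a t / (1 + t) < 1/4`, so `g` never reaches `1/4` (intermediate value theorem from `g (inl m) = 0`),
whence `φ (g) = g` all along. [cite: MilnorHCobordism1965, Cor. 3.5, Lemma 3.7] -/
theorem Cobordism.IsMorseFunction.g_eq_of_mem_regionOver [Nonempty X.bdry.carrier] {g : X.W → ℝ}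
    (hg : X.IsMorseFunction g) {φ : ℝ → ℝ} (hφ : ∀ w, w ≤ 1 / 4 → φ w = w) {D : FlowoutInput n X.W}
    (hD : D.f = fun z => φ (g z)) (Γ : D.Cover) (ha : Γ.a ≤ 1 / 4) {x : X.W}
    (hx : x ∈ (Γ.openCollar X.bdry).regionOver X.inlPart) :
    g x = collarStretch Γ.a ((Γ.openCollar X.bdry).height x) := by
  set C := Γ.openCollar X.bdry with hC
  obtain ⟨hxr, hxp⟩ := hx
  obtain ⟨m, hm⟩ : ∃ m, X.inlB m = C.proj x := by
    have : C.proj x ∈ range X.inlB := by rw [X.range_inlB]; exact hxp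
    exact this
  set T := C.height x with hT
  have hT0 : 0 ≤ T := C.height_nonneg x hxr
  -- the collar line from `inl m` to `x`
  set γ : ℝ → X.W := fun t => C.toFun (X.inlB m) t with hγ
  have hγT : γ T = x := by simp only [hγ, hm, hT]; exact C.apply_proj_height x hxr
  have hγ0 : g (γ 0) = 0 := by simp only [hγ, C.apply_zero]; exact hg.2.1 m
  have hγc : ContinuousOn γ (Icc 0 T) := by
    refine C.continuousOn_toFun.comp (continuousOn_const.prodMk continuousOn_id) ?_
    intro t ht; exact ⟨mem_univ _, ht.1⟩
  have hfγ : ∀ t, 0 ≤ t → D.f (γ t) = collarStretch Γ.a t := fun t ht =>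
    Γ.f_Fl_incl_collarStretch X.bdry (X.inlB m) ht
  have hgc : ContinuousOn (fun t => g (γ t)) (Icc 0 T) :=
    hg.isMorse.contMDiff.continuous.comp_continuousOn hγc
  -- `g x < 1/4`
  have hlt : g x < 1 / 4 := by
    by_contra hle
    push Not at hle
    have hmem : (1 / 4 : ℝ) ∈ Icc (g (γ 0)) (g (γ T)) := ⟨by rw [hγ0]; norm_num, by rwa [hγT]⟩
    obtain ⟨t₀, ht₀, hgt₀⟩ := intermediate_value_Icc hT0 hgc hmem
    have h1 : D.f (γ t₀) = 1 / 4 := by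
      simp only [hD, hgt₀]; exact hφ _ le_rfl
    have h2 : D.f (γ t₀) < 1 / 4 := by
      rw [hfγ t₀ ht₀.1]; exact (collarStretch_lt Γ.a_pos ht₀.1).trans_le ha
    linarith
  have h3 : D.f x = g x := by simp only [hD]; exact hφ _ hlt.le
  rw [← h3, ← hγT, hfγ T hT0]

end Ends

end Literature.Topology.FourManifolds
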